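import Literature.MathematicalPhysics.KineticTheory.InfiniteChainObservables
import Mathlib.MeasureTheory.Measure.ProbabilityMeasure

/-!
# Window embedding of the finite chain into the infinite chain (definitions)

Definitions used by the proof of the route item `ParityLiouvilleSeed.WindowLimit`
(`stmt-AtomisticToContinuum-13982`, bulk-window compactness) and its helper files
`ParityLiouvilleSeedWindowLimit*.lean`:

* `embed N c : PhaseSpace N → ChainConfig` — the configuration of the `N`-chain read in a window
  centred at site `c` (site `z` of `ℤ` reads site `z + c` of `Fin N`, and `(0, 0)` outside);
* `windowMap N a n h` — the restriction of a phase-space point to the box `{a, …, a+n} ⊆ Fin N`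
  (literally the map appearing in the regularity hypothesis of `WindowLimit`);
* `toPM ν`, `windowPM μ` — bundled probability measures (the weak topology of
  `MeasureTheory.ProbabilityMeasure` is used for the Prokhorov extraction);
* `centreCurrent P μ` — the mean current through the centre bond `(⌊N/2⌋, ⌊N/2⌋ + 1)`.

Only definitions and their immediate `rfl`/measurability API live here.
-/

noncomputable section

open MeasureTheory Filter Topology Set
open Literature.MathematicalPhysics.KineticTheory.HeatConduction

namespace Summit.AtomisticToContinuum.FouriersLaw.Theorems.WindowLimit

/-- Embedding of the `N`-chain phase space into the configuration space of the infinite chain,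
window centre `c`: site `z ∈ ℤ` reads site `z + c` of the finite chain, and `(0, 0)` when
`z + c ∉ [0, N)`. [folklore] -/
def embed (N c : ℕ) (x : PhaseSpace N) : ChainConfig := fun z =>
  if h : 0 ≤ z + c ∧ z + c < N then
    (x.1 ⟨(z + c).toNat, by omega⟩, x.2 ⟨(z + c).toNat, by omega⟩)
  else (0, 0)

/-- The value of `embed` at a site inside the chain. [folklore] -/
theorem embed_apply_of (N c : ℕ) (x : PhaseSpace N) {z : ℤ} (h : 0 ≤ z + c ∧ z + c < N) :
    embed N c x z = (x.1 ⟨(z + c).toNat, by omega⟩, x.2 ⟨(z + c).toNat, by omega⟩) := by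
  simp [embed, h]

/-- The value of `embed` at a site outside the chain. [folklore] -/
theorem embed_apply_of_not (N c : ℕ) (x : PhaseSpace N) {z : ℤ}
    (h : ¬ (0 ≤ z + c ∧ z + c < N)) : embed N c x z = (0, 0) := by
  simp [embed, h]

/-- `embed` at the site `z = i - c` reads the coordinate `i`. [folklore] -/
theorem embed_apply_fin (N c : ℕ) (x : PhaseSpace N) (i : Fin N) :
    embed N c x ((i : ℤ) - c) = (x.1 i, x.2 i) := by
  have h : 0 ≤ ((i : ℤ) - c) + c ∧ ((i : ℤ) - c) + c < N := by
    have := i.isLt; constructor <;> omega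
  rw [embed_apply_of N c x h]
  have hi : (⟨(((i : ℤ) - c) + c).toNat, by omega⟩ : Fin N) = i := by
    apply Fin.ext
    simp only
    omega
  rw [hi]

/-- `embed` is measurable. [folklore] -/
theorem measurable_embed (N c : ℕ) : Measurable (embed N c) := by
  refine measurable_pi_iff.mpr fun z => ?_
  by_cases h : 0 ≤ z + c ∧ z + c < N
  · have : (fun x : PhaseSpace N => embed N c x z) =
        fun x => (x.1 ⟨(z + c).toNat, by omega⟩, x.2 ⟨(z + c).toNat, by omega⟩) := by
      funext x; exact embed_apply_of N c x h
    rw [this]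
    exact ((measurable_pi_apply _).comp measurable_fst).prodMk
      ((measurable_pi_apply _).comp measurable_snd)
  · have : (fun x : PhaseSpace N => embed N c x z) = fun _ => ((0 : ℝ), (0 : ℝ)) := by
      funext x; exact embed_apply_of_not N c x h
    rw [this]
    exact measurable_const

/-- `embed` is continuous. [folklore] -/
theorem continuous_embed (N c : ℕ) : Continuous (embed N c) := by
  refine continuous_pi fun z => ?_
  by_cases h : 0 ≤ z + c ∧ z + c < N
  · have : (fun x : PhaseSpace N => embed N c x z) =
        fun x => (x.1 ⟨(z + c).toNat, by omega⟩, x.2 ⟨(z + c).toNat, by omega⟩) := by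
      funext x; exact embed_apply_of N c x h
    rw [this]
    exact (((continuous_apply _).comp continuous_fst).prodMk
      ((continuous_apply _).comp continuous_snd))
  · have : (fun x : PhaseSpace N => embed N c x z) = fun _ => ((0 : ℝ), (0 : ℝ)) := by
      funext x; exact embed_apply_of_not N c x h
    rw [this]
    exact continuous_const

/-- The embedded (window) image of a probability measure is a probability measure. [folklore] -/
theorem isProbabilityMeasure_map_embed {N : ℕ} (c : ℕ) (μ : Measure (PhaseSpace N))
    [IsProbabilityMeasure μ] : IsProbabilityMeasure (μ.map (embed N c)) :=
  Measure.isProbabilityMeasure_map (measurable_embed N c).aemeasurable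

/-- Restriction of a phase-space point of the `N`-chain to the box `{a, …, a + n}` (as a point of
the box space `Fin (n+1) → ℝ × ℝ`); literally the map of the regularity hypothesis of
`WindowLimit`. [folklore] -/
def windowMap (N a n : ℕ) (h : a + (n + 1) ≤ N) (x : PhaseSpace N) : Fin (n + 1) → ℝ × ℝ :=
  fun i => (x.1 (Fin.castLE h (Fin.natAdd a i)), x.2 (Fin.castLE h (Fin.natAdd a i)))

/-- Unfolding `windowMap`. [folklore] -/
theorem windowMap_apply (N a n : ℕ) (h : a + (n + 1) ≤ N) (x : PhaseSpace N) (i : Fin (n + 1)) :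
    windowMap N a n h x i = (x.1 (Fin.castLE h (Fin.natAdd a i)), x.2 (Fin.castLE h (Fin.natAdd a i))) :=
  rfl

/-- `windowMap` is the (syntactic) map of the regularity hypothesis. [folklore] -/
theorem windowMap_eq (N a n : ℕ) (h : a + (n + 1) ≤ N) :
    windowMap N a n h = fun x => fun i : Fin (n + 1) =>
      (x.1 (Fin.castLE h (Fin.natAdd a i)), x.2 (Fin.castLE h (Fin.natAdd a i))) :=
  rfl

/-- `windowMap` is continuous. [folklore] -/
theorem continuous_windowMap (N a n : ℕ) (h : a + (n + 1) ≤ N) : Continuous (windowMap N a n h) :=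
  continuous_pi fun _ => (((continuous_apply _).comp continuous_fst).prodMk
    ((continuous_apply _).comp continuous_snd))

/-- `windowMap` is measurable. [folklore] -/
theorem measurable_windowMap (N a n : ℕ) (h : a + (n + 1) ≤ N) : Measurable (windowMap N a n h) :=
  (continuous_windowMap N a n h).measurable

/-- **Box restriction of the embedding is the window map**: for a window centre `c` and a box
`{a, …, a+n}` of `ℤ` whose translate `{a + c, …}` lies inside the chain,
`boxRestrictAt a n ∘ embed N c = windowMap N a' n h` with `a' = a + c`. [folklore] -/
theorem boxRestrictAt_embed (N c : ℕ) {a : ℤ} {n a' : ℕ} (ha : a + c = a') (h : a' + (n + 1) ≤ N)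
    (x : PhaseSpace N) : boxRestrictAt a n (embed N c x) = windowMap N a' n h x := by
  funext i
  have hi := i.isLt
  have hz : 0 ≤ (a + (i : ℕ)) + c ∧ (a + (i : ℕ)) + c < N := by constructor <;> omega
  rw [boxRestrictAt_apply, windowMap_apply, embed_apply_of N c x hz]
  have hidx : (⟨((a + (i : ℕ)) + c).toNat, by omega⟩ : Fin N) = Fin.castLE h (Fin.natAdd a' i) := by
    apply Fin.ext
    simp only [Fin.val_castLE, Fin.val_natAdd]
    omega
  rw [hidx]

/-- A probability measure on configurations, bundled as a `ProbabilityMeasure` (so that the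
topology of weak convergence applies). [folklore] -/
def toPM (ν : Measure ChainConfig) [IsProbabilityMeasure ν] : ProbabilityMeasure ChainConfig :=
  ⟨ν, inferInstance⟩

/-- The underlying measure of `toPM ν` is `ν`. [folklore] -/
@[simp] theorem coe_toPM (ν : Measure ChainConfig) [IsProbabilityMeasure ν] :
    ((toPM ν : ProbabilityMeasure ChainConfig) : Measure ChainConfig) = ν := rfl

/-- The window measure of the `N`-chain state `μ` (window centre `⌊N/2⌋`), bundled. [folklore] -/
def windowPM {N : ℕ} (μ : Measure (PhaseSpace N)) [IsProbabilityMeasure μ] :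
    ProbabilityMeasure ChainConfig :=
  haveI := isProbabilityMeasure_map_embed (N / 2) μ
  toPM (μ.map (embed N (N / 2)))

/-- The underlying measure of `windowPM μ`. [folklore] -/
@[simp] theorem coe_windowPM {N : ℕ} (μ : Measure (PhaseSpace N)) [IsProbabilityMeasure μ] :
    ((windowPM μ : ProbabilityMeasure ChainConfig) : Measure ChainConfig) =
      μ.map (embed N (N / 2)) := rfl

/-- The mean current through the centre bond `(⌊N/2⌋, ⌊N/2⌋ + 1)` of the `N`-chain in the state
`μ` (written as a sum over sites to avoid a dependent index; `0` for the empty chain). [folklore] -/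
def centreCurrent (P : OscillatorChain) {N : ℕ} (μ : Measure (PhaseSpace N)) : ℝ :=
  ∑ i : Fin N, if i.val = N / 2 then ∫ x, P.bondCurrent N i x ∂μ else 0

/-- For a non-empty chain the centre current is the mean current of the bond at `⌊N/2⌋`.
[folklore] -/
theorem centreCurrent_eq (P : OscillatorChain) {N : ℕ} (hN : 0 < N) (μ : Measure (PhaseSpace N)) :
    centreCurrent P μ = ∫ x, P.bondCurrent N ⟨N / 2, Nat.div_lt_self hN one_lt_two⟩ x ∂μ := by
  unfold centreCurrent
  rw [Finset.sum_eq_single_of_mem (⟨N / 2, Nat.div_lt_self hN one_lt_two⟩ : Fin N)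
    (Finset.mem_univ _)]
  · simp
  · intro b _ hb
    rw [if_neg]
    exact fun h => hb (Fin.ext h)

end Summit.AtomisticToContinuum.FouriersLaw.Theorems.WindowLimit

end
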